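import Summits.QuantumFields.Balaban3D.Proofs.TransportDirectAC
import HarnessLib

/-!
# R3 (cell `ym3-torus`, YM₃ on T³ — a ladder RUNG, NOT d = 4, NOT the Clay problem), UV3-node side of `stub_pinnedStep` (R-19936-S), v3 currency —
# **THE PINNED TRANSPORT STEP IN DIRECT FIBRE FORM**: the dominated-refinement twin of the lane's ✓`TransportDirectAC.transport41_le_sum_ae_direct`
# ((48)–(49) `dV`-a.e. under `AvgAC` with ONE direct fibre hypothesis `T[w·χB·m₀′·e^{F₀}] ≤ m₁·B` per new history), for the v3 (α) package's a.e.
# induction with WINDOWED pinned weights (`PinnedStep.ineq41_pinned_windowed_ae`, rows `Fibre55WinAC`)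

Seat `ym3-torus-px8` g11.  THEOREMS ONLY (0 `def`, 0 `sorry`); `--supports stmt-QuantumFields-19936 --as helper`; count-neutral.  The v3 twin of ✓p748253
`UV3PinnedTransportStep` §1 (★★OWNER WORD 58 (e)): same cut — the cover is asked for a SMALL mass `m₀` (the pin `𝟙_A·wtP_k`, or the restriction
`𝟙[h ∈ H]·wtP_k`), the direct fibre row for the DOMINATING mass `m₀′` (the package's `wtP_k`, so `Fibre55WinAC` feeds it verbatim) — only the fibre
hypothesis is the DIRECT composite of the v3 rows instead of v1's factored pair.

WHAT IS PROVED (ns `…Theorems.UV3PinnedTransportStepDirect`):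
* ★★ `transport41_le_sum_ae_direct_of_le` — pointwise majorant `ρ ≤ Σ_h m₀(h)e^{F₀(h)}`, `0 ≤ m₀ ≤ m₀′`, cover where `m₀ ≠ 0`, `hdirect` for `m₀′`
  ⟹ `Tρ ≤ Σ_{h′} m₁(h′)·B(h′)` `dV`-a.e.;
* ★ `transport41_le_sum_ae_direct_of_ae_le` — the same from an a.e. majorant (`TransportAC.rnTransport_mono_ae_of_ae_le`; RULING №32 letters).

HONEST SCOPE.  [folklore] measure theory over the lane's transport lemmas; the fibre row is a hypothesis; no bound of [Balaban1985UV3] is proved; S-step ∕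
`HistoryTailL` (19936) NOT proved; nothing continuum ∕ OS ∕ mass-gap ∕ Clay.
References: T. Bałaban, CMP **102** (1985) 255–275 [Balaban1985UV3] ((48)–(49) pp. 267–268, (55) p. 269).
-/

set_option autoImplicit false

noncomputable section

namespace Summit.QuantumFields.YangMills.Theorems.UV3PinnedTransportStepDirect

open MeasureTheory
open Literature.MathematicalPhysics.QuantumFieldTheory.Balaban1983to89
open Literature.MathematicalPhysics.QuantumFieldTheory.Balaban1983to89.AveragingRT (rnTransport)
open Summit.QuantumFields.Balaban3D.Carriers
open Summit.QuantumFields.Balaban3D.Proofs.Transport48 (rnTransport_mono_ae rnTransport_sum_ae integrable_weight_mul)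
open Summit.QuantumFields.Balaban3D.Proofs.TransportAC (rnTransport_mono_ae_of_ae_le)

variable {P : Params} {j : ℕ} {G : Type*} [GaugeGroup G] [MeasurableSpace G] [HaarData G]
  {avg : GaugeField P j G → GaugeField P (j + 1) G}
  {H₀ H₁ : Type*} [Fintype H₀] [Fintype H₁]

/-- ★★ **(48)–(49) `dV`-a.e. UNDER `AvgAC`, DIRECT FIBRE FORM, FOR A DOMINATED REFINEMENT MASS.**  `ρ` integrable, majorised POINTWISE by
`Σ_h m₀(h)·e^{F₀(h)}` with `0 ≤ m₀ ≤ m₀′` and the `m₀′`-summands integrable; weights `w, χB ∈ [0,1]` measurable; SOME new history of full weight above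
`h` wherever the SMALL mass `m₀(h)` is non-zero (`hcover`); and per new history the DIRECT fibre row for `m₀′`:
`T[w(h′)·χB(h′)·m₀′(proj h′)·e^{F₀(proj h′)}] ≤ m₁(h′)·B(h′)` a.e. (`hdirect` — the v3 package's `Fibre55WinAC`, not proved here).  THEN
`Tρ ≤ Σ_{h′} m₁(h′)·B(h′)` `dV`-a.e. (pointwise insertion over the fibres of `proj`, monotonicity∕additivity of `T` a.e., `hdirect`).
[cite: Balaban1985UV3, (48)-(49) pp.267-268 + (55) p.269] -/
theorem transport41_le_sum_ae_direct_of_le (hac : AvgAC avg)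
    (proj : H₁ → H₀) (ρ : Density P j G) (hρ : Integrable ρ (fieldMeasure P j G))
    (m₀ m₀' : H₀ → Density P j G) (F₀ : H₀ → GaugeField P j G → ℝ)
    (w χB : H₁ → Density P j G) (m₁ B : H₁ → Density P (j + 1) G)
    (h41 : ∀ U, ρ U ≤ ∑ h, m₀ h U * Real.exp (F₀ h U))
    (hm₀0 : ∀ h U, 0 ≤ m₀ h U) (hle : ∀ h U, m₀ h U ≤ m₀' h U)
    (hint' : ∀ h, Integrable (fun U => m₀' h U * Real.exp (F₀ h U)) (fieldMeasure P j G))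
    (hw : ∀ h', Measurable (w h')) (hw0 : ∀ h' U, 0 ≤ w h' U) (hw1 : ∀ h' U, w h' U ≤ 1)
    (hχ : ∀ h', Measurable (χB h')) (hχ0 : ∀ h' U, 0 ≤ χB h' U) (hχ1 : ∀ h' U, χB h' U ≤ 1)
    (hcover : ∀ h U, m₀ h U ≠ 0 → ∃ h', proj h' = h ∧ (1 : ℝ) ≤ w h' U * χB h' U)
    (hdirect : ∀ h', (rnTransport avg (fun U => w h' U * χB h' U * (m₀' (proj h') U * Real.exp (F₀ (proj h') U))))
      ≤ᵐ[fieldMeasure P (j + 1) G] fun V => m₁ h' V * B h' V) :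
    rnTransport avg ρ ≤ᵐ[fieldMeasure P (j + 1) G] fun V => ∑ h', m₁ h' V * B h' V := by
  classical
  set g : H₁ → Density P j G := fun h' U => w h' U * χB h' U * (m₀' (proj h') U * Real.exp (F₀ (proj h') U)) with hg
  have hgi : ∀ h', Integrable (g h') (fieldMeasure P j G) := fun h' =>
    integrable_weight_mul (hw h') (hχ h') (hw0 h') (hw1 h') (hχ0 h') (hχ1 h') (hint' (proj h'))
  have hm₀'0 : ∀ h U, 0 ≤ m₀' h U := fun h U => (hm₀0 h U).trans (hle h U)
  have hg0 : ∀ h' U, 0 ≤ g h' U := fun h' U =>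
    mul_nonneg (mul_nonneg (hw0 h' U) (hχ0 h' U)) (mul_nonneg (hm₀'0 _ U) (Real.exp_pos _).le)
  -- pointwise insertion: cover where the small mass lives, then dominate
  have hpt : ∀ U, ρ U ≤ ∑ h', g h' U := by
    intro U
    refine (h41 U).trans ?_
    rw [← Finset.sum_fiberwise Finset.univ proj fun h' => g h' U]
    refine Finset.sum_le_sum fun h _ => ?_
    by_cases hm : m₀ h U = 0
    · rw [hm, zero_mul]; exact Finset.sum_nonneg fun h' _ => hg0 h' U
    · obtain ⟨h₁, hh₁, hone⟩ := hcover h U hm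
      have hpos : 0 ≤ m₀' h U * Real.exp (F₀ h U) := mul_nonneg (hm₀'0 h U) (Real.exp_pos _).le
      have hmem : h₁ ∈ Finset.univ.filter (fun h' => proj h' = h) := Finset.mem_filter.mpr ⟨Finset.mem_univ _, hh₁⟩
      calc m₀ h U * Real.exp (F₀ h U)
          ≤ m₀' h U * Real.exp (F₀ h U) := mul_le_mul_of_nonneg_right (hle h U) (Real.exp_pos _).le
        _ = 1 * (m₀' h U * Real.exp (F₀ h U)) := (one_mul _).symm
        _ ≤ (w h₁ U * χB h₁ U) * (m₀' h U * Real.exp (F₀ h U)) := mul_le_mul_of_nonneg_right hone hpos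
        _ = g h₁ U := by rw [hg]; simp only [hh₁]
        _ ≤ ∑ h' ∈ Finset.univ.filter (fun h' => proj h' = h), g h' U :=
            Finset.single_le_sum (f := fun h' => g h' U) (fun h' _ => hg0 h' U) hmem
  have hA : rnTransport avg ρ ≤ᵐ[fieldMeasure P (j + 1) G] rnTransport avg (fun U => ∑ h', g h' U) :=
    rnTransport_mono_ae hac hpt hρ (integrable_finsetSum _ fun h' _ => hgi h')
  have hBsum : rnTransport avg (fun U => ∑ h', g h' U) =ᵐ[fieldMeasure P (j + 1) G]
      fun V => ∑ h', rnTransport avg (g h') V :=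
    rnTransport_sum_ae hac Finset.univ g fun h' _ => hgi h'
  have hE' := ae_all_iff.mpr hdirect
  filter_upwards [hA, hBsum, hE'] with V hA hBsum hE
  calc rnTransport avg ρ V ≤ rnTransport avg (fun U => ∑ h', g h' U) V := hA
    _ = ∑ h', rnTransport avg (g h') V := hBsum
    _ ≤ ∑ h', m₁ h' V * B h' V := Finset.sum_le_sum fun h' _ => hE h'

/-- ★ **THE SAME FROM AN A.E. MAJORISATION** (`ρ ≥ 0` and `ρ ≤ Σ_h m₀(h)e^{F₀(h)}` `dU`-a.e.; `TransportAC.rnTransport_mono_ae_of_ae_le`).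
[cite: Balaban1985UV3, (48)-(49) pp.267-268] -/
theorem transport41_le_sum_ae_direct_of_ae_le (hac : AvgAC avg)
    (proj : H₁ → H₀) (ρ : Density P j G) (hρ : Integrable ρ (fieldMeasure P j G)) (hρ0 : ∀ U, 0 ≤ ρ U)
    (m₀ m₀' : H₀ → Density P j G) (F₀ : H₀ → GaugeField P j G → ℝ)
    (w χB : H₁ → Density P j G) (m₁ B : H₁ → Density P (j + 1) G)
    (h41 : ρ ≤ᵐ[fieldMeasure P j G] fun U => ∑ h, m₀ h U * Real.exp (F₀ h U))
    (hint : ∀ h, Integrable (fun U => m₀ h U * Real.exp (F₀ h U)) (fieldMeasure P j G))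
    (hm₀0 : ∀ h U, 0 ≤ m₀ h U) (hle : ∀ h U, m₀ h U ≤ m₀' h U)
    (hint' : ∀ h, Integrable (fun U => m₀' h U * Real.exp (F₀ h U)) (fieldMeasure P j G))
    (hw : ∀ h', Measurable (w h')) (hw0 : ∀ h' U, 0 ≤ w h' U) (hw1 : ∀ h' U, w h' U ≤ 1)
    (hχ : ∀ h', Measurable (χB h')) (hχ0 : ∀ h' U, 0 ≤ χB h' U) (hχ1 : ∀ h' U, χB h' U ≤ 1)
    (hcover : ∀ h U, m₀ h U ≠ 0 → ∃ h', proj h' = h ∧ (1 : ℝ) ≤ w h' U * χB h' U)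
    (hdirect : ∀ h', (rnTransport avg (fun U => w h' U * χB h' U * (m₀' (proj h') U * Real.exp (F₀ (proj h') U))))
      ≤ᵐ[fieldMeasure P (j + 1) G] fun V => m₁ h' V * B h' V) :
    rnTransport avg ρ ≤ᵐ[fieldMeasure P (j + 1) G] fun V => ∑ h', m₁ h' V * B h' V := by
  set R : Density P j G := fun U => ∑ h, m₀ h U * Real.exp (F₀ h U) with hR
  have hR0 : ∀ U, 0 ≤ R U := fun U => Finset.sum_nonneg fun h _ => mul_nonneg (hm₀0 h U) (Real.exp_pos _).le
  have hRi : Integrable R (fieldMeasure P j G) := integrable_finsetSum _ fun h _ => hint h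
  have hA : rnTransport avg ρ ≤ᵐ[fieldMeasure P (j + 1) G] rnTransport avg R :=
    rnTransport_mono_ae_of_ae_le hac hρ0 hR0 h41 hρ hRi
  have hmain := transport41_le_sum_ae_direct_of_le hac proj R hRi m₀ m₀' F₀ w χB m₁ B (fun U => le_rfl) hm₀0 hle hint'
    hw hw0 hw1 hχ hχ0 hχ1 hcover hdirect
  filter_upwards [hA, hmain] with V hA hmain
  exact hA.trans hmain

end Summit.QuantumFields.YangMills.Theorems.UV3PinnedTransportStepDirect

end
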